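import Summits.AtomisticToContinuum.BoseEinsteinCondensation.Theorems.BECCutLineWeakDisorderWitnessTransferConvergence
import Summits.AtomisticToContinuum.BoseEinsteinCondensation.Theorems.BECCutLineWeakDisorderWitnessTransferRatio
import Summits.AtomisticToContinuum.BoseEinsteinCondensation.Theses.BECCutLineWeakDisorder
import Literature.MathematicalPhysics.QuantumManyBody.GroundStateFeynmanKacProofs
import HarnessLib

/-!
# Crux `TwoReplicaTransienceBound` (stmt-AtomisticToContinuum-9687): the `T → ∞` limit per box and the
# GROUND-STATE two-replica bound it forces

Support file (does not close the item) for the crux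
`Summit.AtomisticToContinuum.BoseEinsteinCondensation.Theses.BECCutLineWeakDisorder.TwoReplicaTransienceBound`
(route `BECCutLineWeakDisorder`, line `SketchIdeator1`, lead c2). For a BOUNDED measurable pair potential, a box
`Λ_L^{n+1}` and its Feynman–Kac ground state `Ψ₀` (`IsGroundStateFK`, strictly positive on the open box), the
crux's integral along the finite-`T` witnesses `Ψ_T = fkWitness v L T 1` CONVERGES to its value at the ground
state as `T → ∞` (`tendsto_lintegral_ratio_fkWitness_one`): pointwise `Ψ_T → Ψ₀`
(`CutLineWitness.tendsto_fkWitness_one`, Simon's (A7) with `f = 1`), the uniform bound `Ψ_T ≤ K`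
(`CutLineWitness.fkWitness_one_le`), dominated convergence slice by slice and in `Y`
(`CutLineWitness.tendsto_ratioIntegrand`, `CutLineWitness.tendsto_lintegral_ratio`), positivity of the
limit slices on the open box (`CutLineWitness.lintegral_nnnorm_slice_pos`).

Consequence (`twoReplicaTransienceBound_groundState`, registered toolbox stub `stub_groundStateBound`): **the
crux implies the GROUND-STATE TWO-REPLICA BOUND** — for every bounded admissible `v`, small `ρ`, ONE constant
`C` and all large `n`, the Dirichlet ground state `Ψ₀` of `n+1` particles in the box of side
`((n+1)/ρ)^{1/3}` (it exists, `GroundStateFeynmanKac_holds`, and is unique, `IsGroundStateFK.unique`)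
satisfies `∫ L³ m_{Ψ₀}(Y)²/s_{Ψ₀}(Y)² dY ≤ C`. This is the `T = ∞`, `δ = 0` endpoint of the route's hinge
(`LandscapeBound` asks the same of some nonnegative `δ`-near-minimising `C¹` trial state for every `δ > 0`):
a typed NECESSARY condition for the crux over the tree's ground-state vocabulary, uniform in `n` like the
crux and free of the polymer length.

## References

* B. Simon, *Schrödinger semigroups*, Bull. AMS 7 (1982), §A1 (A5)–(A7). [Simon1982]
* K. L. Chung, Z. Zhao, *From Brownian Motion to Schrödinger's Equation* (1995), Thms 3.17, 3.27.
  [ChungZhao1995]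
-/

noncomputable section

open MeasureTheory Filter Set
open scoped ENNReal NNReal Topology

namespace Summit.AtomisticToContinuum.BoseEinsteinCondensation.Cruxes.TwoReplicaTransienceBound.GroundStateLimit

open Literature.MathematicalPhysics.QuantumManyBody.BoseGas
open Summit.AtomisticToContinuum.BoseEinsteinCondensation.Theorems.CutLineWitness

variable {n : ℕ}

/-- **`T → ∞` limit of the crux's integral in a fixed box**: for bounded measurable `v`, `L > 0` and a
Feynman–Kac ground state `Ψ₀` of `n+1` particles that is positive on the open box,
`∫ L³ m_{Ψ_T}²/s_{Ψ_T}² dY → ∫ L³ m_{Ψ₀}²/s_{Ψ₀}² dY` along `Ψ_T = fkWitness v L T 1`.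
[cite: Simon1982, §A1 (A7) p. 449] -/
theorem tendsto_lintegral_ratio_fkWitness_one {v : ℝ → ℝ≥0∞} (hv : Measurable v) {C : ℝ≥0}
    (hC : ∀ r, v r ≤ C) {L : ℝ} (hL : 0 < L) {Ψ₀ : Config (n + 1) → ℝ} (h : IsGroundStateFK v L Ψ₀)
    (hpos : ∀ X ∈ boxN (n + 1) L, 0 < Ψ₀ X) :
    Tendsto (fun T : ℝ => ∫⁻ Y : Config n, ENNReal.ofReal (L ^ 3) *
        (∫⁻ x, (‖fkWitness (N := n + 1) v L T (fun _ => (1 : ℝ≥0∞)) (Matrix.vecCons x Y)‖₊ : ℝ≥0∞) ^ 2) ^ 2 /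
          (∫⁻ x, (‖fkWitness (N := n + 1) v L T (fun _ => (1 : ℝ≥0∞)) (Matrix.vecCons x Y)‖₊ : ℝ≥0∞)) ^ 2)
      atTop
      (𝓝 (∫⁻ Y : Config n, ENNReal.ofReal (L ^ 3) *
        (∫⁻ x, (‖Ψ₀ (Matrix.vecCons x Y)‖₊ : ℝ≥0∞) ^ 2) ^ 2 /
          (∫⁻ x, (‖Ψ₀ (Matrix.vecCons x Y)‖₊ : ℝ≥0∞)) ^ 2)) := by
  obtain ⟨K, hK⟩ := fkWitness_one_le hv hC hL h
  -- regularised family `f T = Ψ_{max T 1}` (bounded and Dirichlet for ALL `T`), equal to `Ψ_T` eventually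
  set f : ℝ → Config (n + 1) → ℝ := fun T => fkWitness (N := n + 1) v L (max T 1) (fun _ => (1 : ℝ≥0∞))
    with hf
  have h1 : ∀ T : ℝ, (1 : ℝ) ≤ max T 1 := fun T => le_max_right _ _
  have hfm : ∀ T, Measurable (f T) := fun T => measurable_fkWitness hv L _ measurable_const
  have hbound : ∀ T X, |f T X| ≤ K := fun T X => by
    rw [hf, abs_of_nonneg (fkWitness_nonneg v L _ _ X)]
    exact hK _ (h1 T) X
  have hsupp : ∀ T X, X ∉ boxN (n + 1) L → f T X = 0 := fun T X hX =>
    fkWitness_of_notMem v (zero_le_one.trans (h1 T)) _ hX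
  have hlim : ∀ X, Tendsto (fun T => f T X) atTop (𝓝 (Ψ₀ X)) := fun X => by
    refine (tendsto_fkWitness_one hv hC hL h X).congr' ?_
    filter_upwards [eventually_ge_atTop (1 : ℝ)] with T hT
    simp only [hf, max_eq_left hT]
  -- convergence of the integrand at every slice
  have hlimI : ∀ᵐ Y : Config n, Tendsto (fun T => ENNReal.ofReal (L ^ 3) *
        (∫⁻ x, (‖f T (Matrix.vecCons x Y)‖₊ : ℝ≥0∞) ^ 2) ^ 2 /
          (∫⁻ x, (‖f T (Matrix.vecCons x Y)‖₊ : ℝ≥0∞)) ^ 2) atTop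
      (𝓝 (ENNReal.ofReal (L ^ 3) * (∫⁻ x, (‖Ψ₀ (Matrix.vecCons x Y)‖₊ : ℝ≥0∞) ^ 2) ^ 2 /
          (∫⁻ x, (‖Ψ₀ (Matrix.vecCons x Y)‖₊ : ℝ≥0∞)) ^ 2)) := by
    refine Eventually.of_forall fun Y => ?_
    by_cases hY : Y ∈ boxN n L
    · exact tendsto_ratioIntegrand hfm hbound hsupp hlim
        (lintegral_nnnorm_slice_pos hL h.measurable hpos hY)
    · -- off the box every slice vanishes identically, before and after the limit
      have h0 : ∀ T (x : Space), f T (Matrix.vecCons x Y) = 0 :=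
        fun T x => hsupp T _ fun hX => hY (vecCons_mem_boxN_iff.1 hX).2
      have h0' : ∀ x : Space, Ψ₀ (Matrix.vecCons x Y) = 0 :=
        fun x => h.eq_zero _ fun hX => hY (vecCons_mem_boxN_iff.1 hX).2
      simp only [h0, h0', nnnorm_zero, ENNReal.coe_zero]
      exact tendsto_const_nhds
  have hmain := tendsto_lintegral_ratio hfm hbound hsupp hlimI
  refine hmain.congr' ?_
  filter_upwards [eventually_ge_atTop (1 : ℝ)] with T hT
  simp only [hf, max_eq_left hT]

/-- **The crux forces the ground-state two-replica bound.** If `TwoReplicaTransienceBound` holds then for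
every admissible BOUNDED `v` there is `ρ₀ > 0` such that for `0 < ρ < ρ₀` one constant `C` serves all large
`n`: the (unique, strictly positive) Feynman–Kac ground state `Ψ₀` of `n+1` particles in the Dirichlet box of
side `((n+1)/ρ)^{1/3}` has `∫ L³ m_{Ψ₀}(Y)²/s_{Ψ₀}(Y)² dY ≤ C` (the `T → ∞` limit of the crux's bound
along the witnesses; existence `GroundStateFeynmanKac_holds`, uniqueness `IsGroundStateFK.unique`).
[cite: Simon1982, §A1 (A7) p. 449] -/
theorem twoReplicaTransienceBound_groundState
    (hT : Summit.AtomisticToContinuum.BoseEinsteinCondensation.Theses.BECCutLineWeakDisorder.TwoReplicaTransienceBound)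
    (v : ℝ → ℝ≥0∞) (hv : IsRepulsiveFiniteRange v) (hb : ∃ C : ℝ≥0, ∀ r, v r ≤ C) :
    ∃ ρ₀ : ℝ, 0 < ρ₀ ∧ ∀ ρ : ℝ, 0 < ρ → ρ < ρ₀ → ∃ C : ℝ, 0 < C ∧ ∀ᶠ n : ℕ in Filter.atTop,
      ∀ Ψ₀ : Config (n + 1) → ℝ, IsGroundStateFK v (sideLength ρ (n + 1)) Ψ₀ →
        ∫⁻ Y : Config n, ENNReal.ofReal (sideLength ρ (n + 1) ^ 3) *
            (∫⁻ x, (‖Ψ₀ (Matrix.vecCons x Y)‖₊ : ℝ≥0∞) ^ 2) ^ 2 /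
            (∫⁻ x, (‖Ψ₀ (Matrix.vecCons x Y)‖₊ : ℝ≥0∞)) ^ 2 ≤ ENNReal.ofReal C := by
  obtain ⟨Cv, hCv⟩ := hb
  obtain ⟨ρ₀, hρ₀, H⟩ := hT v hv
  refine ⟨ρ₀, hρ₀, fun ρ hρ hρlt => ?_⟩
  obtain ⟨C, hC, hev⟩ := H ρ hρ hρlt
  refine ⟨C, hC, ?_⟩
  filter_upwards [hev] with n hn Ψ₀ hΨ₀
  have hL : 0 < sideLength ρ (n + 1) :=
    Real.rpow_pos_of_pos (div_pos (by exact_mod_cast Nat.succ_pos n) hρ) _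
  -- the given ground state is THE positive one
  obtain ⟨Φ, hΦ, -, hΦpos⟩ :=
    GroundStateFeynmanKac_holds (n + 1) (sideLength ρ (n + 1)) v (Nat.le_add_left 1 n) hL hv.1 ⟨Cv, hCv⟩
  have hEq : Ψ₀ = Φ := hΨ₀.unique hΦ
  subst hEq
  exact le_of_tendsto (tendsto_lintegral_ratio_fkWitness_one hv.1 hCv hL hΨ₀ hΦpos)
    (Filter.eventually_atTop.2 ⟨1, fun T hT1 => hn T hT1⟩)

end Summit.AtomisticToContinuum.BoseEinsteinCondensation.Cruxes.TwoReplicaTransienceBound.GroundStateLimit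

namespace Summit.AtomisticToContinuum.BoseEinsteinCondensation.Cruxes.TwoReplicaTransienceBound.TracerDecoupling

open Literature.MathematicalPhysics.QuantumManyBody.BoseGas

/-- **Registered toolbox stub `stub_groundStateBound`** (crux stmt-AtomisticToContinuum-9687, line
`SketchIdeator1`): the crux implies the GROUND-STATE two-replica bound for bounded admissible potentials
(`= GroundStateLimit.twoReplicaTransienceBound_groundState`). -/
theorem stub_groundStateBound :
    Summit.AtomisticToContinuum.BoseEinsteinCondensation.Theses.BECCutLineWeakDisorder.TwoReplicaTransienceBound →
      ∀ (v : ℝ → ENNReal), IsRepulsiveFiniteRange v → (∃ C : NNReal, ∀ r, v r ≤ C) →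
        ∃ ρ₀ : ℝ, 0 < ρ₀ ∧ ∀ (ρ : ℝ), 0 < ρ → ρ < ρ₀ → ∃ C : ℝ, 0 < C ∧ ∀ᶠ n : ℕ in Filter.atTop,
          ∀ (Ψ₀ : Config (n + 1) → ℝ), IsGroundStateFK v (sideLength ρ (n + 1)) Ψ₀ →
            ∫⁻ Y : Config n, ENNReal.ofReal (sideLength ρ (n + 1) ^ 3) *
                (∫⁻ x, (‖Ψ₀ (Matrix.vecCons x Y)‖₊ : ENNReal) ^ 2) ^ 2 /
                (∫⁻ x, (‖Ψ₀ (Matrix.vecCons x Y)‖₊ : ENNReal)) ^ 2 ≤ ENNReal.ofReal C :=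
  GroundStateLimit.twoReplicaTransienceBound_groundState

end Summit.AtomisticToContinuum.BoseEinsteinCondensation.Cruxes.TwoReplicaTransienceBound.TracerDecoupling

end
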